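import Summits.Ventures.WeilGRH.TwistedTwoPrimeCertSound
import Summits.Ventures.WeilGRH.TwistedMomentWindowFour
import HarnessLib

/-!
# Moment-method certificates for TWISTED Weil weights, XII: from a checked two-prime certificate to the rung of `L(s, χ)`

Cell `rh-explicit`, WEIL TRACK — GRH ARM (namespace `Summit.Ventures.WeilGRH`).  The two-prime analogue of
`TwistedMomentDirichlet.lean`.  For a Dirichlet character `χ` mod `q ≠ 1` (any parity) with REAL values
`χ(2) = s₂`, `χ(3) = s₃ ∈ {−1, 0, 1}`:

* `weilPrimeRippleChar_three_of_chi` — the twisted ripple on the window `N = 3` is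
  `s₂·√2 log 2·cos(τ log 2) + s₃·(2 log 3/√3)·cos(τ log 3)` (`Λ(2)/√2·2 = √2 log 2`, `Λ(3)/√3·2 = 2 log 3/√3`);
* dictionary `twistWeight23_le_weilFinitePrimeWeightChar_sub`: `twistWeight23 s₂ s₃ ≤ M_{χ,3} − (log q − log π)`;
* `weilFinitePrimeQuadraticChar_three_nonneg_of_twistCert23` — `0 ≤ E_{χ,3}(g)` on `C(b)` from a certificate
  `c : TwistCert23` whose cells pass `checkCellsZS23 s₂ s₃ …` and whose algebra passes `checkAlg`, with `ellLo ≤ log q − log π`;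
* **`weilPositivityOnChar_of_twistCert23`** — the rung `WeilPositivityOnChar χ t` for every `t ≤ b` with `e^{2t} ≤ 4`
  (`weilQuadraticChar_re_eq_weilFinitePrimeQuadraticChar` with `N = 3`); the `59/100` and `log 2` rungs as corollaries
  (`…_fiftynine_…`, `…_log_two_…`; window tests `59/100 ≤ b`, `logTwoHi ≤ b`);
* the `χ(4) = 0` extension (`weilPrimeRippleChar_four_eq_three_of_chi_four`, `weilPositivityOnChar_of_twistCert23_of_chi_four`:
  `e^{2t} ≤ 5`, e.g. the odd character mod 4 up to `(log 5)/2` — its odd-parity certificate needs the bonus layer, a later file).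

DATA: exact certificates in this format exist for the even class `5.4` (`χ(2) = χ(3) = −1`) at `59/100` and at `log 2`
(EXTREMALS/GRH/twisted-2ripple-CERT).  Everything here is PROVED; no named facts; nothing about zeros of `L(s, χ)`.
-/

noncomputable section

open Complex Finset MeasureTheory Set Filter
open scoped Real Topology ComplexConjugate BigOperators ArithmeticFunction.vonMangoldt

namespace Summit.Ventures.WeilGRH

open Literature.NumberTheory.LFunctions
open Literature.Analysis.ValidatedNumerics.Numerics
open Literature.Analysis.SpecialFunctions

variable {q : ℕ}

/-! ## The ripple of `M_{χ,3}` for real values `χ(2) = s₂`, `χ(3) = s₃` -/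

/-- For `χ(2) = s₂`, `χ(3) = s₃` real, the twisted ripple on the window `N = 3` is
`s₂·√2 log 2·cos(τ log 2) + s₃·(2 log 3/√3)·cos(τ log 3)`. [folklore] -/
theorem weilPrimeRippleChar_three_of_chi (χ : DirichletCharacter ℂ q) {s₂ s₃ : ℤ}
    (hχ2 : χ ((2 : ℕ) : ZMod q) = (s₂ : ℂ)) (hχ3 : χ ((3 : ℕ) : ZMod q) = (s₃ : ℂ)) (τ : ℝ) :
    weilPrimeRippleChar χ 3 τ = (s₂ : ℝ) * (Real.sqrt 2 * Real.log 2 * Real.cos (τ * Real.log 2)) +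
      (s₃ : ℝ) * (2 * Real.log 3 / Real.sqrt 3 * Real.cos (τ * Real.log 3)) := by
  have h2 := weilPrimeRippleChar_two_of_chi_two χ hχ2 τ
  have hstep : weilPrimeRippleChar χ 3 τ = weilPrimeRippleChar χ 2 τ +
      (Λ 3 : ℝ) / Real.sqrt 3 * (2 * ((χ ((3 : ℕ) : ZMod q)).re * Real.cos (τ * Real.log 3) +
        (χ ((3 : ℕ) : ZMod q)).im * Real.sin (τ * Real.log 3))) := by
    unfold weilPrimeRippleChar
    rw [Finset.sum_range_succ]
    push_cast
    ring_nf
  have h3 : (Λ 3 : ℝ) = Real.log 3 := by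
    rw [ArithmeticFunction.vonMangoldt_apply_prime Nat.prime_three]; push_cast; ring
  rw [hstep, h2, h3, hχ3]
  have hre : ((s₃ : ℂ)).re = (s₃ : ℝ) := by simp
  have him : ((s₃ : ℂ)).im = 0 := by simp
  rw [hre, him]
  ring

/-- **Dictionary.** For `χ` mod `q` with `χ(2) = s₂`, `χ(3) = s₃` real:
`twistWeight23 s₂ s₃ τ ≤ M_{χ,3}(τ) − (log q − log π)` (equality for even `χ`). [folklore] -/
theorem twistWeight23_le_weilFinitePrimeWeightChar_sub (χ : DirichletCharacter ℂ q) {s₂ s₃ : ℤ}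
    (hχ2 : χ ((2 : ℕ) : ZMod q) = (s₂ : ℂ)) (hχ3 : χ ((3 : ℕ) : ZMod q) = (s₃ : ℂ)) (τ : ℝ) :
    twistWeight23 s₂ s₃ τ ≤ weilFinitePrimeWeightChar χ 3 τ - (Real.log q - Real.log π) := by
  unfold weilFinitePrimeWeightChar
  rw [weilPrimeRippleChar_three_of_chi χ hχ2 hχ3 τ]
  have h := twistWeight23_le_parity s₂ s₃ (charParity_le_one χ) τ
  linarith

/-- For `χ(4) = 0` the `n = 4` spike is absent: `ρ_{χ,4} = ρ_{χ,3}`. [folklore] -/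
theorem weilPrimeRippleChar_four_eq_three_of_chi_four (χ : DirichletCharacter ℂ q)
    (h4 : χ ((4 : ℕ) : ZMod q) = 0) : weilPrimeRippleChar χ 4 = weilPrimeRippleChar χ 3 := by
  have h4' : χ (4 : ZMod q) = 0 := by simpa using h4
  funext τ
  unfold weilPrimeRippleChar
  rw [Finset.sum_range_succ]
  simp [h4']

/-- For `χ(4) = 0`: `E_{χ,4}(g) = E_{χ,3}(g)`. [folklore] -/
theorem weilFinitePrimeQuadraticChar_four_eq_three_of_chi_four (χ : DirichletCharacter ℂ q)
    (h4 : χ ((4 : ℕ) : ZMod q) = 0) (g : ℝ → ℂ) :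
    weilFinitePrimeQuadraticChar χ 4 g = weilFinitePrimeQuadraticChar χ 3 g := by
  unfold weilFinitePrimeQuadraticChar weilFinitePrimeWeightChar
  rw [weilPrimeRippleChar_four_eq_three_of_chi_four χ h4]

/-! ## From the two checkers to the rung -/

/-- **`E_{χ,3} ≥ 0` on `C(b)` from a checked twisted two-prime certificate** (`χ` of any parity with real
`χ(2) = s₂`, `χ(3) = s₃`, `|s_i| ≤ 1`; cells accepted by `checkCellsZS23`, algebra by `checkAlg`, `ellLo ≤ log q − log π`). [folklore] -/
theorem weilFinitePrimeQuadraticChar_three_nonneg_of_twistCert23 (c : TwistCert23) {s₂ s₃ : ℤ} {p j M : ℕ}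
    (hcells : checkCellsZS23 s₂ s₃ p j c.frame.wL c.frame.T M c.cells = true) (halg : c.checkAlg = true)
    (χ : DirichletCharacter ℂ q) (hχ2 : χ ((2 : ℕ) : ZMod q) = (s₂ : ℂ)) (hχ3 : χ ((3 : ℕ) : ZMod q) = (s₃ : ℂ))
    (hℓ : ((c.ellLo : ℚ) : ℝ) ≤ Real.log q - Real.log π)
    {g : ℝ → ℂ} (hg : IsWeilTest g) (hsupp : tsupport g ⊆ Icc (-(c.b : ℝ)) c.b) :
    0 ≤ weilFinitePrimeQuadraticChar χ 3 g := by
  have hOK := cellsOKW23_of_checkCellsZS23 hcells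
  set W : ℝ → ℝ := fun τ ↦ weilFinitePrimeWeightChar χ 3 τ - (Real.log q - Real.log π) with hW
  have hwW : ∀ τ, twistWeight23 s₂ s₃ τ ≤ W τ :=
    fun τ ↦ twistWeight23_le_weilFinitePrimeWeightChar_sub χ hχ2 hχ3 τ
  have hWi : Integrable fun t : ℝ ↦ ‖weilMellin g (1 / 2 + t * I)‖ ^ 2 * W t := by
    have h1 := integrable_norm_sq_weilMellin_mul_weilFinitePrimeWeightChar hg χ 3
    have h2 := (integrable_norm_sq_weilMellin_half_line hg).mul_const (Real.log q - Real.log π)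
    refine (h1.sub h2).congr (Eventually.of_forall fun τ ↦ ?_)
    simp only [Pi.sub_apply, hW]
    ring
  have hmain := TwistCert23.form_nonneg_of_check_mono halg hOK (twistWeight23_neg s₂ s₃) hwW hℓ hg hWi hsupp
  have hsplit : weilFinitePrimeQuadraticChar χ 3 g =
      (Real.log q - Real.log π) * weilNorm2Sq g +
        1 / (2 * π) * ∫ t : ℝ, ‖weilMellin g (1 / 2 + t * I)‖ ^ 2 * W t := by
    unfold weilFinitePrimeQuadraticChar
    have h1 := integrable_norm_sq_weilMellin_half_line hg
    have e : (fun τ : ℝ ↦ ‖weilMellin g (1 / 2 + τ * I)‖ ^ 2 * weilFinitePrimeWeightChar χ 3 τ) =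
        fun τ : ℝ ↦ ‖weilMellin g (1 / 2 + τ * I)‖ ^ 2 * W τ +
          (Real.log q - Real.log π) * ‖weilMellin g (1 / 2 + τ * I)‖ ^ 2 := by
      funext τ; rw [hW]; ring
    rw [e, integral_add hWi (h1.const_mul _), integral_const_mul, integral_norm_sq_weilMellin_half_line hg]
    set X := ∫ t : ℝ, ‖weilMellin g (1 / 2 + t * I)‖ ^ 2 * W t
    have hπ : (π : ℝ) ≠ 0 := Real.pi_ne_zero
    field_simp
    ring
  rw [hsplit]
  exact hmain

/-- **The rung from a checked twisted two-prime certificate**: `WeilPositivityOnChar χ t` for every `t ≤ b` with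
`e^{2t} ≤ 4` (on such windows `Re Q_χ(g) = E_{χ,3}(g)`). [folklore] -/
theorem weilPositivityOnChar_of_twistCert23 (c : TwistCert23) {s₂ s₃ : ℤ} {p j M : ℕ}
    (hcells : checkCellsZS23 s₂ s₃ p j c.frame.wL c.frame.T M c.cells = true) (halg : c.checkAlg = true)
    (hq : q ≠ 1) (χ : DirichletCharacter ℂ q) (hχ2 : χ ((2 : ℕ) : ZMod q) = (s₂ : ℂ))
    (hχ3 : χ ((3 : ℕ) : ZMod q) = (s₃ : ℂ)) (hℓ : ((c.ellLo : ℚ) : ℝ) ≤ Real.log q - Real.log π)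
    {t : ℝ} (htb : t ≤ (c.b : ℝ)) (ht4 : Real.exp (2 * t) ≤ 4) :
    WeilPositivityOnChar χ t := by
  intro g hg hsupp
  have h4 : Real.exp (2 * t) ≤ ((3 : ℕ) : ℝ) + 1 := by norm_num; exact ht4
  rw [weilQuadraticChar_re_eq_weilFinitePrimeQuadraticChar hq χ hg h4 hsupp]
  exact weilFinitePrimeQuadraticChar_three_nonneg_of_twistCert23 c hcells halg χ hχ2 hχ3 hℓ hg
    (hsupp.trans (Icc_subset_Icc (by linarith) htb))

/-- **The rung for `χ(4) = 0`**: `WeilPositivityOnChar χ t` for every `t ≤ b` with `e^{2t} ≤ 5`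
(`E_{χ,4} = E_{χ,3}`; e.g. the characters mod `4`). [folklore] -/
theorem weilPositivityOnChar_of_twistCert23_of_chi_four (c : TwistCert23) {s₂ s₃ : ℤ} {p j M : ℕ}
    (hcells : checkCellsZS23 s₂ s₃ p j c.frame.wL c.frame.T M c.cells = true) (halg : c.checkAlg = true)
    (hq : q ≠ 1) (χ : DirichletCharacter ℂ q) (hχ2 : χ ((2 : ℕ) : ZMod q) = (s₂ : ℂ))
    (hχ3 : χ ((3 : ℕ) : ZMod q) = (s₃ : ℂ)) (hχ4 : χ ((4 : ℕ) : ZMod q) = 0)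
    (hℓ : ((c.ellLo : ℚ) : ℝ) ≤ Real.log q - Real.log π)
    {t : ℝ} (htb : t ≤ (c.b : ℝ)) (ht5 : Real.exp (2 * t) ≤ 5) :
    WeilPositivityOnChar χ t := by
  intro g hg hsupp
  have h5 : Real.exp (2 * t) ≤ ((4 : ℕ) : ℝ) + 1 := by norm_num; exact ht5
  rw [weilQuadraticChar_re_eq_weilFinitePrimeQuadraticChar hq χ hg h5 hsupp,
    weilFinitePrimeQuadraticChar_four_eq_three_of_chi_four χ hχ4]
  exact weilFinitePrimeQuadraticChar_three_nonneg_of_twistCert23 c hcells halg χ hχ2 hχ3 hℓ hg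
    (hsupp.trans (Icc_subset_Icc (by linarith) htb))

/-- **The `59/100` rung from a checked twisted two-prime certificate** (window test `59/100 ≤ b`; `e^{1.18} ≤ 4`). [folklore] -/
theorem weilPositivityOnChar_fiftynine_of_twistCert23 (c : TwistCert23) {s₂ s₃ : ℤ} {p j M : ℕ}
    (hcells : checkCellsZS23 s₂ s₃ p j c.frame.wL c.frame.T M c.cells = true) (halg : c.checkAlg = true)
    (hb : (59 / 100 : ℚ) ≤ c.b)
    (hq : q ≠ 1) (χ : DirichletCharacter ℂ q) (hχ2 : χ ((2 : ℕ) : ZMod q) = (s₂ : ℂ))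
    (hχ3 : χ ((3 : ℕ) : ZMod q) = (s₃ : ℂ)) (hℓ : ((c.ellLo : ℚ) : ℝ) ≤ Real.log q - Real.log π) :
    WeilPositivityOnChar χ (59 / 100) := by
  refine weilPositivityOnChar_of_twistCert23 c hcells halg hq χ hχ2 hχ3 hℓ ?_ ?_
  · have h : (((59 / 100 : ℚ)) : ℝ) ≤ ((c.b : ℚ) : ℝ) := by exact_mod_cast hb
    push_cast at h
    exact h
  · have h4 : (4 : ℝ) = Real.exp (2 * Real.log 2) := by
      rw [show 2 * Real.log 2 = Real.log 4 by
        rw [show (4 : ℝ) = 2 ^ 2 by norm_num, Real.log_pow]; push_cast; ring, Real.exp_log (by norm_num)]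
    rw [h4, Real.exp_le_exp]
    have h := Real.log_two_gt_d9
    linarith

/-- **The `log 2` rung from a checked twisted two-prime certificate** (window test `logTwoHi ≤ b`). [folklore] -/
theorem weilPositivityOnChar_log_two_of_twistCert23 (c : TwistCert23) {s₂ s₃ : ℤ} {p j M : ℕ}
    (hcells : checkCellsZS23 s₂ s₃ p j c.frame.wL c.frame.T M c.cells = true) (halg : c.checkAlg = true)
    (hb : logTwoHi ≤ c.b)
    (hq : q ≠ 1) (χ : DirichletCharacter ℂ q) (hχ2 : χ ((2 : ℕ) : ZMod q) = (s₂ : ℂ))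
    (hχ3 : χ ((3 : ℕ) : ZMod q) = (s₃ : ℂ)) (hℓ : ((c.ellLo : ℚ) : ℝ) ≤ Real.log q - Real.log π) :
    WeilPositivityOnChar χ (Real.log 2) := by
  refine weilPositivityOnChar_of_twistCert23 c hcells halg hq χ hχ2 hχ3 hℓ ?_ ?_
  · have h2 : ((logTwoHi : ℚ) : ℝ) ≤ c.b := by exact_mod_cast hb
    have h1 := log_two_half_le_of_check (a0 := logTwoHi / 2) (by rw [mul_div_cancel₀ _ (two_ne_zero)])
    push_cast at h1
    linarith
  · rw [show 2 * Real.log 2 = Real.log 4 by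
      rw [show (4 : ℝ) = 2 ^ 2 by norm_num, Real.log_pow]; push_cast; ring, Real.exp_log (by norm_num)]

end Summit.Ventures.WeilGRH

end
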